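import Summits.BirchSwinnertonDyer.Rank1Residual.Additive.ChiBranchRatCharEqOfRouteG
import Summits.BirchSwinnertonDyer.Rank1Residual.Additive.CongruentPartnerBudgetSchemaHolds
import Summits.BirchSwinnertonDyer.Rank1Residual.AdditivePotMult.PotMultBudgetRankZeroEnds
import Summits.BirchSwinnertonDyer.Rank1Residual.Supersingular.DescentLowerBound
import HarnessLib

/-!
# Q6 REGISTER CONSUMERS v6: census record at `n₀` + ONE residual Selmer count `≥ n₀` ⟹ `BSD(E,p)` in rank
# `0` on X4♯(G-ord) ∩ `I₀*` ∩ {`ρ̄` onto} and on X4(M) ∩ {`ρ̄` onto} — the Route-G ends with the budget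
# `BudgetLeLambdaAt p W n₀` DISCHARGED from Greenberg 1999 Prop. 4.14 (AUTOMATIC on X4: `E[p]` irreducible ⟹
# `p ∤ #E(ℚ)_tors`) + cc-typer-2's schema with (L1)/(L2) proved by n1011-p12 (cell `b2b-bsdres`, team
# n1011, seat n1011-p06 gen 3 = the Q6 register seat, `cells/n1011/PREDICTIONS-Q6.md`; composes
# census-ctyper1 p255810/`CensusQ6CoeffValuation.lean`, p10 `CongruentPartnerMainConjectureGordBSD.lean`,
# p07-g3 `PotMultBudgetRankZeroEnds.lean`, cc-typer-2 `CongruentPartnerBudgetSchema.lean`, n1011-p12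
# `CongruentPartnerBudgetSchemaHolds.lean` and this seat's `ChiBranchRatCharEqOfRouteG.lean` BY NAME)

HONEST FRAMING (cell `b2b-bsdres`, run/shared/lean/b2b/bsd-rank1-residual/, verbatim in every
file): the goal of the cell is to DELETE the COMBINATION-SHAPED residual classes of the
Birch–Swinnerton-Dyer formula for ALL analytic-rank `≤ 1` elliptic curves over `ℚ` — "full BSD
formula for every rank `≤ 1` curve in class `C`" assembled STRICTLY from published theorems — so
that the rank-`≤ 1` remainder becomes exactly the CONSTRUCTION-SHAPED classes, which are TYPED
(missing-input `Prop`s), NOT attempted. This is not "finishing BSD". Team n1011 (N10 / N11, the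
semistable-twist locus of X4 in rank `0`): research route on CONSTRUCTION-SHAPED classes; census output =
EVIDENCE / per-pair CERTIFICATE-EVIDENCE, never a Literature fact; X4♯(G-ord) / X4(M) stay
CONSTRUCTION-SHAPED; RESIDUAL-MAP marks UNCHANGED; nothing is booked. THEOREMS ONLY (no definition, no
named fact). Named facts enter as HYPOTHESES (`hK` Kato 2004 Thm. 17.4 (3) half-eigen reading; `h414`
Greenberg 1999 Prop. 4.14 record; Delbourgo 1998 Prop. 4 `hDel98`/`hDel`/`hDelX`; Delbourgo 2002
`hDel`/`hDel3`; `hPal` where the parity-uniform (M) chain or p10's even end carries it; GZK; modularity).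
TYPED per-pair inputs (hypotheses, BY NAME): the Q6 record `CensusQ6.Gord[Odd]FirstUnitIndexAt W p n₀` /
`CensusQ6.Mult[Odd]FirstUnitIndexAt W p n₀` (CERTIFICATE-EVIDENCE, two engines) and the ONE residual count
`ResidualSelmerRankGeAt p W n₀` (cc-typer-2's typed input; NO printed discharge today — on these
IRREDUCIBLE rows its intended source is EPW 2006 Cor. 3.2.5, on reducible rows Greenberg 2010 Prop. 3.2.1
(b) to be instantiated; ROUTE-2 II.13.2 / LIT-INPUTS-P3 §29; no engine of the cell computes it today).
Row binders `hcm`, `hna` as in the ends consumed. `p ∤ #E(ℚ)_tors` is NOT a binder here: it is a THEOREM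
on X4 (`Supersingular.not_dvd_torsionOrder_of_irr`, from the tree's `padicValNat_torsionOrder_eq_zero_of_irreducible`).
PROP-4.14 SETTING RIDER (referee 1 R12.1, lead R5-43 (b); A234 doc-only rider; n1011-lit GEN 6 page verdict
LIT-INPUTS-P3 §41 'PRINT-EXACT'): the printed proof of Greenberg 1999 Prop. 4.14 runs in the (potentially)
ORDINARY-or-MULTIPLICATIVE setting at `v ∣ p`, which Greenberg derives inside the proof from the `Λ`-cotorsion
hypothesis (LNM 1716 p. 113; [corpus: book:coates1999-arithmetic-theory-elliptic-curves p. 124]); every row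
consumed in this file is inside that case (§1/§3: X4♯(G-ord) = potentially good ordinary at `p`; §2: X4(M) =
potentially multiplicative at `p`) — on O5/O6 (potentially supersingular) rows `Λ`-cotorsion is not available
in print (LNM 1716 Thm. 1.7), so the Prop-4.14 budget is not instantiated on O5/O6 rows without a separate
source, and no form below is stated for such a row.

## What (every step BY NAME; nothing restated)

`budgetLeLambdaAt_of_prop414_of_residualSurj'' p h414 (not_dvd_torsionOrder_of_irr W p hirr) hres :
BudgetLeLambdaAt p W n₀` (cc-typer-2 ∘ n1011-p12) replaces `hbud` in the record-fed Route-G ends: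
* §1 X4♯(G-ord): `ClassX4Gord.bsdp_three_rankZero_of_katoHalf_of_gordOddFirstUnitIndexAt_of_residualSurj_of_nonAnomalous`
  (p = 3, Pal-FREE over p10's `_noPal` end — the 15 (G-ord)@3 register rows, 6 of them non-anomalous),
  `ClassX4Gord.bsdp_rankZero_of_katoHalf_of_gord[Odd]FirstUnitIndexAt_of_residualSurj_of_nonAnomalous`
  (p ≥ 5; the 7 (G-ord)@5 register rows);
* §2 X4(M): `ClassX4M.bsdp_three_rankZero_of_surj_of_katoHalf_of_firstUnitIndex_of_residualSurj` (the 98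
  (M)@3 register rows) and `ClassX4M.bsdp_rankZero_of_surj_of_katoHalf_of_firstUnitIndex_of_residualSurj`
  (every odd p; the 19 (M)@5/7 rows);
* §3 the T-N10R rational nodes in the same currency:
  `ClassX4Gord.chiBranchRatCharEq[Odd]At_of_katoHalf_of_gord[Odd]FirstUnitIndexAt_of_residualSurj`.
READING for the register (`PREDICTIONS-Q6.md` A11–A13): per register row the consumer families v4
(rational node), v5 (budget) and v6 (residual count) differ ONLY in the ONE typed input they carry;
v6's is the weakest-looking but equally unprinted today. Nothing about any curve is asserted; nothing
booked; no mark / label moved.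

References: K. Kato, Astérisque 295 (2004) Thm. 17.4 (3) [Kato2004Asterisque]; R. Greenberg, LNM 1716
(1999) Prop. 4.14 [GreenbergLNM1716]; Y. Hachimori, K. Matsuno, Proc. AMS 128 (2000) Cor. (i)
[HachimoriMatsuno2000]; R. Greenberg, Kyoto J. Math. 50 (2010) Prop. 3.2.1 [Greenberg2010] (shape of the
residual input; nothing asserted); D. Delbourgo, Compositio 113 (1998) Prop. 4 [Delbourgo1998], J. Number
Theory 95 (2002) Thm. (A), (B) [Delbourgo2002]; A. Pal, Proc. AMS 140 (2012) Thm. 3.2 [Pal2012];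
R. L. Miller, LMS J. Comput. Math. 14 (2011) Def. 1.1 [Miller2011LMS]; HOME/cells/n1011/PREDICTIONS-Q6.md.
-/

set_option autoImplicit false

noncomputable section

open scoped Classical MatrixGroups ModularForm NumberField

open CongruenceSubgroup WeierstrassCurve NumberField Literature.NumberTheory.EllipticCurves
  Literature.NumberTheory.EllipticCurves.ModularForms
  Literature.NumberTheory.EllipticCurves.Rank1Residual
  Literature.NumberTheory.EllipticCurves.Rank1Residual.Typed
  Literature.NumberTheory.GaloisRepresentations
  Literature.NumberTheory.EllipticCurves.Wuthrich2014
  Literature.NumberTheory.EllipticCurves.Delbourgo2002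
  Summit.BirchSwinnertonDyer.Rank1Residual.AdditivePotMult
  Summit.BirchSwinnertonDyer.Rank1Residual.X1.MuLambda
  Summit.BirchSwinnertonDyer.Rank1Residual.Iwasawa
  IsDedekindDomain

open Summit.BirchSwinnertonDyer.Rank1Residual.Supersingular (not_dvd_torsionOrder_of_irr)

namespace Summit.BirchSwinnertonDyer.Rank1Residual.Additive

variable {W : WeierstrassCurve ℚ} [W.IsElliptic] [W.IsGloballyMinimal] {p : ℕ} [hp : Fact p.Prime]

/-! ### §0 The budget on an X4 row from ONE residual count (Prop. 4.14 automatic: `E[p]` irreducible) -/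

/-- **On X4 (`E[p]` irreducible) the Route-G budget `BudgetLeLambdaAt p W b` follows from ONE residual
Selmer count `ResidualSelmerRankGeAt p W b`** — Greenberg 1999 Prop. 4.14 BY NAME (`p ∤ #E(ℚ)_tors` is
automatic from irreducibility) + cc-typer-2's schema with (L1)/(L2) proved by n1011-p12. SETTING RIDER
(referee 1 R12.1): the record `h414` is Prop. 4.14, whose printed proof runs in the (potentially)
ordinary-or-multiplicative setting at `v ∣ p` (derived there from `Λ`-cotorsion); the Prop-4.14 budget is not
instantiated on O5/O6 (potentially supersingular) rows without a separate source — use this form only on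
X4♯(G-ord) / X4(M) rows, as §§1–3 do.
[cite: GreenbergLNM1716, Prop. 4.14 (p. 114)] [cite: SilvermanAEC2009, Thm X.4.2(a)]
[cite: Greenberg2010, Prop. 3.2.1 (shape of the residual input; nothing asserted)] -/
theorem budgetLeLambdaAt_of_prop414_of_irr_of_residualSurj
    (h414 : Greenberg1999.prop414_noFiniteSubmodule_of_not_dvd_torsionOrder) (hirr : Irr W p)
    {b : ℕ} (hres : ResidualSelmerRankGeAt p W b) : BudgetLeLambdaAt p W b :=
  budgetLeLambdaAt_of_prop414_of_residualSurj'' p h414 (not_dvd_torsionOrder_of_irr W p hirr) hres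

/-! ### §1 X4♯(G-ord) ∩ `I₀*` ∩ {`ρ̄` onto}, rank `0`: Q6 record + ONE residual count ⟹ `BSD(E,p)` -/

/-- **(G-ord)@3 register rows, Pal-FREE:** X4♯(G-ord) at `3` ∧ surj(3), `r_an = 0`, non-CM, non-anomalous:
the Q6 odd record `CensusQ6.GordOddFirstUnitIndexAt W 3 n₀` + ONE residual count `ResidualSelmerRankGeAt 3 W n₀`
⟹ `BSD(E,3)` (p10's `…_of_coeffCert_of_budget_of_nonAnomalous_noPal` ∘ census-ctyper1's interlock ∘ §0).
[cite: Delbourgo2002, Theorem (A), (B) (p. 40), Hypothesis (p. 39)] [cite: Kato2004Asterisque, Thm. 17.4 (3) (p. 273)]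
[cite: Delbourgo1998, Prop. 4 (p. 144)] [cite: GreenbergLNM1716, Prop. 4.14 (p. 114)] [cite: Miller2011LMS, §1 and Def. 1.1] -/
theorem ClassX4Gord.bsdp_three_rankZero_of_katoHalf_of_gordOddFirstUnitIndexAt_of_residualSurj_of_nonAnomalous
    [Fact (Nat.Prime 3)] {W : WeierstrassCurve ℚ} [W.IsElliptic] [W.IsGloballyMinimal]
    (hK : Wuthrich2014.kato_halfEigenCharIdeal_dvd_cyclotomicPrime_of_surjective)
    (h414 : Greenberg1999.prop414_noFiniteSubmodule_of_not_dvd_torsionOrder)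
    (hDel98 : Delbourgo1998.prop4_rankZero_pow_dvd_constantCoeff)
    (hDel3 : Delbourgo2002.mainTheorem_three)
    (hGZK : rank_eq_analyticRank_of_analyticRank_le_one) (hmod : hasEntireLFunction_rat)
    (hmodD : nonempty_modularParametrizationData)
    (hX : ClassX4Gord W 3) (hcm : ¬ W.HasCM) (hsurj : Surj W 3) (hr : W.analyticRank = 0)
    {n₀ : ℕ} (hrec : CensusQ6.GordOddFirstUnitIndexAt W 3 n₀) (hres : ResidualSelmerRankGeAt 3 W n₀)
    (hna : ReductionNonAnomalous W 3) : BSDp W 3 :=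
  ClassX4Gord.bsdp_three_rankZero_of_katoHalf_of_coeffCert_of_budget_of_nonAnomalous_noPal hK hDel98 hDel3
    hGZK hmod hmodD hX hcm hsurj hr (CensusQ6.branchUnitCoeffAt_of_gordOddFirstUnitIndexAt (by decide) hrec)
    (budgetLeLambdaAt_of_prop414_of_irr_of_residualSurj h414 hX.classX4.2.2 hres) hna

/-- **(G-ord), `p ≥ 5`, `p ≡ 1 (mod 4)`:** record `CensusQ6.GordFirstUnitIndexAt W p n₀` + ONE residual count
⟹ `BSD(E,p)` (rank `0`, non-CM, non-anomalous; `hPal` as in p10's even end).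
[cite: Delbourgo2002, Theorem (A), (B) (p. 40)] [cite: Kato2004Asterisque, Thm. 17.4 (3) (p. 273)]
[cite: Delbourgo1998, Prop. 4 (p. 144)] [cite: GreenbergLNM1716, Prop. 4.14 (p. 114)] [cite: Miller2011LMS, §1 and Def. 1.1] -/
theorem ClassX4Gord.bsdp_rankZero_of_katoHalf_of_gordFirstUnitIndexAt_of_residualSurj_of_nonAnomalous
    (hK : Wuthrich2014.kato_halfEigenCharIdeal_dvd_cyclotomicPrime_of_surjective)
    (hPal : Pal2012.thm32_sqrt_mul_realPeriodRat_twist_eq_of_prime_one_mod_four)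
    (h414 : Greenberg1999.prop414_noFiniteSubmodule_of_not_dvd_torsionOrder)
    (hDel98 : Delbourgo1998.prop4_rankZero_pow_dvd_constantCoeff) (hDel : Delbourgo2002.mainTheorem)
    (hGZK : rank_eq_analyticRank_of_analyticRank_le_one) (hmod : hasEntireLFunction_rat)
    (hmodD : nonempty_modularParametrizationData)
    (hX : ClassX4Gord W p) (hcm : ¬ W.HasCM) (hp5 : 5 ≤ p) (hp4 : p % 4 = 1)
    (he : semistabilityIndex W p = 2) (hsurj : Surj W p) (hr : W.analyticRank = 0)
    {n₀ : ℕ} (hrec : CensusQ6.GordFirstUnitIndexAt W p n₀) (hres : ResidualSelmerRankGeAt p W n₀)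
    (hna : ReductionNonAnomalous W p) : BSDp W p :=
  ClassX4Gord.bsdp_rankZero_of_katoHalf_of_gordFirstUnitIndexAt_of_budget_of_nonAnomalous hK hPal hDel98 hDel
    hGZK hmod hmodD hX hcm hp5 hp4 he hsurj hr hrec
    (budgetLeLambdaAt_of_prop414_of_irr_of_residualSurj h414 hX.classX4.2.2 hres) hna

/-- **(G-ord), `p ≥ 5`, `p ≡ 3 (mod 4)`:** odd record + ONE residual count ⟹ `BSD(E,p)` (`hPal` carried only
for p10's uniform end). [cite: Delbourgo2002, Theorem (A), (B) (p. 40)] [cite: Kato2004Asterisque, Thm. 17.4 (3) (p. 273)]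
[cite: Delbourgo1998, Prop. 4 (p. 144)] [cite: GreenbergLNM1716, Prop. 4.14 (p. 114)] [cite: Miller2011LMS, §1 and Def. 1.1] -/
theorem ClassX4Gord.bsdp_rankZero_of_katoHalf_of_gordOddFirstUnitIndexAt_of_residualSurj_of_nonAnomalous
    (hK : Wuthrich2014.kato_halfEigenCharIdeal_dvd_cyclotomicPrime_of_surjective)
    (hPal : Pal2012.thm32_sqrt_mul_realPeriodRat_twist_eq_of_prime_one_mod_four)
    (h414 : Greenberg1999.prop414_noFiniteSubmodule_of_not_dvd_torsionOrder)
    (hDel98 : Delbourgo1998.prop4_rankZero_pow_dvd_constantCoeff) (hDel : Delbourgo2002.mainTheorem)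
    (hGZK : rank_eq_analyticRank_of_analyticRank_le_one) (hmod : hasEntireLFunction_rat)
    (hmodD : nonempty_modularParametrizationData)
    (hX : ClassX4Gord W p) (hcm : ¬ W.HasCM) (hp5 : 5 ≤ p) (hp4 : p % 4 = 3)
    (he : semistabilityIndex W p = 2) (hsurj : Surj W p) (hr : W.analyticRank = 0)
    {n₀ : ℕ} (hrec : CensusQ6.GordOddFirstUnitIndexAt W p n₀) (hres : ResidualSelmerRankGeAt p W n₀)
    (hna : ReductionNonAnomalous W p) : BSDp W p :=
  ClassX4Gord.bsdp_rankZero_of_katoHalf_of_gordOddFirstUnitIndexAt_of_budget_of_nonAnomalous hK hPal hDel98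
    hDel hGZK hmod hmodD hX hcm hp5 hp4 he hsurj hr hrec
    (budgetLeLambdaAt_of_prop414_of_irr_of_residualSurj h414 hX.classX4.2.2 hres) hna

/-! ### §3 The T-N10R rational nodes in the same currency (record + ONE residual count) -/

/-- **Q6 record + ONE residual count ⟹ the even rational node `ChiBranchRatCharEqAt W p`** on X4♯(G-ord) ∩
`I₀*` ∩ {`ρ̄` onto}, `p ≡ 1 (mod 4)`. [cite: Kato2004Asterisque, Thm. 17.4 (3) (p. 273)]
[cite: GreenbergLNM1716, Prop. 4.14 (p. 114)] -/
theorem ClassX4Gord.chiBranchRatCharEqAt_of_katoHalf_of_gordFirstUnitIndexAt_of_residualSurj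
    (hK : Wuthrich2014.kato_halfEigenCharIdeal_dvd_cyclotomicPrime_of_surjective)
    (h414 : Greenberg1999.prop414_noFiniteSubmodule_of_not_dvd_torsionOrder)
    (hX : ClassX4Gord W p) (he : semistabilityIndex W p = 2) (hsurj : Surj W p) (hp4 : p % 4 = 1)
    {n₀ : ℕ} (hrec : CensusQ6.GordFirstUnitIndexAt W p n₀) (hres : ResidualSelmerRankGeAt p W n₀) :
    ChiBranchRatCharEqAt W p :=
  hX.chiBranchRatCharEqAt_of_katoHalf_of_gordFirstUnitIndexAt_of_budget hK he hsurj hp4 hrec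
    (budgetLeLambdaAt_of_prop414_of_irr_of_residualSurj h414 hX.classX4.2.2 hres)

/-- **Q6 odd record + ONE residual count ⟹ the odd rational node `ChiBranchRatCharEqOddAt W p`** (`p ≡ 3
(mod 4)`, `p = 3` included). [cite: Kato2004Asterisque, Thm. 17.4 (3) (p. 273)] [cite: GreenbergLNM1716, Prop. 4.14 (p. 114)] -/
theorem ClassX4Gord.chiBranchRatCharEqOddAt_of_katoHalf_of_gordOddFirstUnitIndexAt_of_residualSurj
    (hK : Wuthrich2014.kato_halfEigenCharIdeal_dvd_cyclotomicPrime_of_surjective)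
    (h414 : Greenberg1999.prop414_noFiniteSubmodule_of_not_dvd_torsionOrder)
    (hX : ClassX4Gord W p) (he : semistabilityIndex W p = 2) (hsurj : Surj W p) (hp4 : p % 4 = 3)
    {n₀ : ℕ} (hrec : CensusQ6.GordOddFirstUnitIndexAt W p n₀) (hres : ResidualSelmerRankGeAt p W n₀) :
    ChiBranchRatCharEqOddAt W p :=
  hX.chiBranchRatCharEqOddAt_of_katoHalf_of_gordOddFirstUnitIndexAt_of_budget hK he hsurj hp4 hrec
    (budgetLeLambdaAt_of_prop414_of_irr_of_residualSurj h414 hX.classX4.2.2 hres)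

end Summit.BirchSwinnertonDyer.Rank1Residual.Additive

/-! ### §2 X4(M) ∩ {`ρ̄` onto}, rank `0`: Q6 record + ONE residual count ⟹ `BSD(E,p)` (p07-g3's ends) -/

namespace Summit.BirchSwinnertonDyer.Rank1Residual.AdditivePotMult

open CongruenceSubgroup WeierstrassCurve NumberField Literature.NumberTheory.EllipticCurves
  Literature.NumberTheory.EllipticCurves.ModularForms
  Literature.NumberTheory.EllipticCurves.Rank1Residual
  Literature.NumberTheory.EllipticCurves.Rank1Residual.Typed
  Literature.NumberTheory.GaloisRepresentations
  Summit.BirchSwinnertonDyer.Rank1Residual.Additive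
  IsDedekindDomain

open Summit.BirchSwinnertonDyer.Rank1Residual.Supersingular (not_dvd_torsionOrder_of_irr)

variable {W : WeierstrassCurve ℚ} [W.IsElliptic] [W.IsGloballyMinimal] {p : ℕ} [hp : Fact p.Prime]

/-- **(M) register rows, every odd `p`:** X4(M) ∧ surj(p) ∧ `r_an = 0`: the Q6 record at index `b` (even or
odd branch by `p mod 4`) + ONE residual count `ResidualSelmerRankGeAt p W b` ⟹ `BSD(E,p)` — p07-g3's
`ClassX4M.bsdp_rankZero_of_surj_of_katoHalf_of_firstUnitIndex_of_budget` with the budget from Greenberg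
Prop. 4.14 (automatic: `E[p]` irreducible) + the schema. [cite: Kato2004Asterisque, Thm. 17.4 (3) (p. 273)]
[cite: Delbourgo1998, Prop. 4 (p. 144)] [cite: GreenbergLNM1716, Prop. 4.14 (p. 114)] [cite: Miller2011LMS, §1 and Def. 1.1] -/
theorem ClassX4M.bsdp_rankZero_of_surj_of_katoHalf_of_firstUnitIndex_of_residualSurj
    (hK : Wuthrich2014.kato_halfEigenCharIdeal_dvd_cyclotomicPrime_of_surjective)
    (hDel : Delbourgo1998.prop4_rankZero_pow_dvd_constantCoeff)
    (hDelX : Delbourgo1998.prop4_rankZero_constantCoeff_eq_unit_mul_of_potMult)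
    (hPal : Pal2012.thm32_sqrt_mul_realPeriodRat_twist_eq_of_prime_one_mod_four)
    (h414 : Greenberg1999.prop414_noFiniteSubmodule_of_not_dvd_torsionOrder)
    (hGZK : rank_eq_analyticRank_of_analyticRank_le_one) (hmod : hasEntireLFunction_rat)
    (hmodD : nonempty_modularParametrizationData)
    (hX : ClassX4M W p) (hsurj : Surj W p) (hr : W.analyticRank = 0) {b : ℕ}
    (hrec : (p % 4 = 1 → CensusQ6.MultFirstUnitIndexAt W p b) ∧
      (p % 4 = 3 → CensusQ6.MultOddFirstUnitIndexAt W p b))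
    (hres : ResidualSelmerRankGeAt p W b) : BSDp W p :=
  hX.bsdp_rankZero_of_surj_of_katoHalf_of_firstUnitIndex_of_budget hK hDel hDelX hPal hGZK hmod hmodD hsurj hr
    hrec (budgetLeLambdaAt_of_prop414_of_irr_of_residualSurj h414 hX.classX4.2.2 hres)

/-- **The 98 (M)@3 register rows' shape:** X4(M) ∧ surj(3) ∧ `r_an = 0`: the Q6 odd record
`MultOddFirstUnitIndexAt W 3 b` + ONE residual count `ResidualSelmerRankGeAt 3 W b` ⟹ `BSD(E,3)` (`hPal`
carried only for p07-g3's parity-uniform chain). [cite: Kato2004Asterisque, Thm. 17.4 (3) (p. 273)]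
[cite: Delbourgo1998, Prop. 4 (p. 144)] [cite: GreenbergLNM1716, Prop. 4.14 (p. 114)] [cite: Miller2011LMS, Def. 1.1] -/
theorem ClassX4M.bsdp_three_rankZero_of_surj_of_katoHalf_of_firstUnitIndex_of_residualSurj
    [Fact (Nat.Prime 3)] {W : WeierstrassCurve ℚ} [W.IsElliptic] [W.IsGloballyMinimal]
    (hK : Wuthrich2014.kato_halfEigenCharIdeal_dvd_cyclotomicPrime_of_surjective)
    (hDel : Delbourgo1998.prop4_rankZero_pow_dvd_constantCoeff)
    (hDelX : Delbourgo1998.prop4_rankZero_constantCoeff_eq_unit_mul_of_potMult)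
    (hPal : Pal2012.thm32_sqrt_mul_realPeriodRat_twist_eq_of_prime_one_mod_four)
    (h414 : Greenberg1999.prop414_noFiniteSubmodule_of_not_dvd_torsionOrder)
    (hGZK : rank_eq_analyticRank_of_analyticRank_le_one) (hmod : hasEntireLFunction_rat)
    (hmodD : nonempty_modularParametrizationData)
    (hX : ClassX4M W 3) (hsurj : Surj W 3) (hr : W.analyticRank = 0) {b : ℕ}
    (hrec : CensusQ6.MultOddFirstUnitIndexAt W 3 b) (hres : ResidualSelmerRankGeAt 3 W b) : BSDp W 3 :=
  hX.bsdp_three_rankZero_of_surj_of_katoHalf_of_firstUnitIndex_of_budget hK hDel hDelX hPal hGZK hmod hmodD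
    hsurj hr hrec (budgetLeLambdaAt_of_prop414_of_irr_of_residualSurj h414 hX.classX4.2.2 hres)

end Summit.BirchSwinnertonDyer.Rank1Residual.AdditivePotMult

end
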